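import Summits.SmoothPoincare4.SmoothPoincare4.Theorems.ConvexBisectionAcyclicBisectionExistsDualLinkPageLink
import Summits.SmoothPoincare4.SmoothPoincare4.Theorems.ConvexBisectionAcyclicBisectionExistsDualLinkFraming
import HarnessLib

/-!
# Dual handles, T3c-3: the dual link is a page link — the contract `T3c-1′ ∧ T3c-2 ⟹ T3c-3`,
# checked by the kernel
(sub-goal T3c-3 `node_dualLink_pageLink` of stub `stub_steinRealisation` (NF6), line
`modp-braid-orbits` r11, crux `ConvexBisection.AcyclicBisectionExists`, item stmt-SmoothPoincare4-10508;
wave 3, lead c5; registered sub-goal `helper_isFramingAlong_trans`)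

Sequel of `…DualLinkSeamPush.lean`, `…DualLinkTransport.lean` (transport of isotopies of framed links
along the seam), `…DualLinkPageLink.lean` (ISO + TUBE on the `Base g` side) and `…DualLinkFraming.lean`
(the dual framed knots).  Here:

* §1 the two readings of the seam and of its differential: through `Ψ : bX.carrier ≅ bW.carrier` and
  the restriction `R : ∂X ≅ bX.carrier` of the identity (the form of node T3c-2: lifts `z = R y`,
  `u = dR(w)`), or through `seamDiffeo bX bW Ψ` on the canonical carriers (the form of the transport
  files) — `coe_seamDiffeo` and its derivative `mfderiv_seamDiffeo`; concatenation of framing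
  families with a propositional junction (`isFramingAlong_trans` = `helper_isFramingAlong_trans`);
* §2 **`dualLink_pageLink_of_nodes`** — node T3c-3 PROVED FROM the node statements T3c-1′
  (`node_belt_isotopic_pushoff` with V6's corrected shadow clause `shadow = ±(l.get j).1`) and T3c-2
  (`node_seam_transport`), both taken at the data as hypotheses: the dual attaching maps of the suffix
  handles are replaced (ISO + TUBE) by attaching maps along page curves of non-zero shadow and UNIFORM
  page twisting `±1`, every multi-attachment along the dual maps being one along the new maps.  The
  chain: dual framed knots (`attachingFraming_pushedMap`, positive rescaling by `κ`) → push of T3c-1′'s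
  isotopy along the seam (`helper_linkIsotopy_seamTransport`) → push of T3c-1′'s end homotopy of
  framings (`framingHomotopic_seamPush`) → T3c-2's isotopy, read through the lifts `z = R(·)`,
  `u = dR(tail ·)` (`mfderiv_incl_tail`, §1) → `helper_dualLink_pageLink_of`.

Everything is proved; no named facts, no `sorry`.

## References
* J. Milnor, *Lectures on the h-cobordism theorem* (1965), §3 (dual handles). [MilnorHCobordism1965]
* A. A. Kosinski, *Differential Manifolds* (1993), VI §6 and VIII, proof of (1.2). [Kosinski1993]
* R. İ. Baykur, *Kähler decomposition of 4-manifolds*, AGT 6 (2006), proof of Thm. 5.1. [Baykur2006]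
-/

noncomputable section

-- the prescribed namespace `Summit.<P>.<Sub>.…` duplicates `SmoothPoincare4` (P = Sub)
set_option linter.dupNamespace false

open scoped Manifold ContDiff Topology

namespace Summit.SmoothPoincare4.SmoothPoincare4.Theorems.AcyclicBisectionExists.ModpBraidOrbits

open Set Function Filter Metric Topology Bundle
open Literature.Topology.FourManifolds Literature.Topology.FourManifolds.HandleAttachingMap
  Literature.Topology.FourManifolds.BoundaryManifold Literature.Topology.FourManifolds.LefschetzBase
  Literature.Geometry.Symplectic

/-! ## §1 The two readings of the seam; junctions of framing families -/

section Seam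

variable {X : Type} [TopologicalSpace X] [ChartedSpace (EuclideanHalfSpace 4) X] [IsManifold (𝓡∂ 4) ∞ X]
  {W : Type} [TopologicalSpace W] [ChartedSpace (EuclideanHalfSpace 4) W] [IsManifold (𝓡∂ 4) ∞ W]

/-- **The differential of the seam, in its two readings**: for `R : ∂X ≅ bX.carrier` the restriction of
the identity, `d(bW.incl ∘ Ψ)_{R y} (dR_y w) = d(incl ∘ seamDiffeo bX bW Ψ)_y (w)` (chain rule on
`coe_seamDiffeo`). [cite: LeeSmoothManifolds2013, Thm. 5.11] -/
theorem mfderiv_seamDiffeo (bX : BoundaryData (𝓡∂ 4) X (𝓡 3)) (bW : BoundaryData (𝓡∂ 4) W (𝓡 3))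
    (Ψ : bX.carrier ≃ₘ⟮𝓡 3, 𝓡 3⟯ bW.carrier) (y : (BoundaryManifold.boundaryData 3 X).carrier)
    (w : EuclideanSpace ℝ (Fin 3)) :
    mfderiv (𝓡 3) (𝓡∂ 4) (fun y => bW.incl (Ψ y))
        ((BoundaryManifold.boundaryData 3 X).restrictDiffeomorph bX (Diffeomorph.refl (𝓡∂ 4) X ∞) y)
        (mfderiv (𝓡 3) (𝓡 3)
          ((BoundaryManifold.boundaryData 3 X).restrictDiffeomorph bX (Diffeomorph.refl (𝓡∂ 4) X ∞)) y w) =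
      mfderiv (𝓡 3) (𝓡∂ 4) (fun y => (BoundaryManifold.boundaryData 3 W).incl (seamDiffeo bX bW Ψ y)) y w := by
  have hRd : HasMFDerivAt (𝓡 3) (𝓡 3)
      ((BoundaryManifold.boundaryData 3 X).restrictDiffeomorph bX (Diffeomorph.refl (𝓡∂ 4) X ∞)) y
      (mfderiv (𝓡 3) (𝓡 3)
        ((BoundaryManifold.boundaryData 3 X).restrictDiffeomorph bX (Diffeomorph.refl (𝓡∂ 4) X ∞)) y) :=
    ((((BoundaryManifold.boundaryData 3 X).restrictDiffeomorph bX (Diffeomorph.refl (𝓡∂ 4) X ∞)).contMDiff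
      y).mdifferentiableAt (by simp)).hasMFDerivAt
  have hΨd : HasMFDerivAt (𝓡 3) (𝓡∂ 4) (fun y => bW.incl (Ψ y))
      ((BoundaryManifold.boundaryData 3 X).restrictDiffeomorph bX (Diffeomorph.refl (𝓡∂ 4) X ∞) y)
      (mfderiv (𝓡 3) (𝓡∂ 4) (fun y => bW.incl (Ψ y))
        ((BoundaryManifold.boundaryData 3 X).restrictDiffeomorph bX (Diffeomorph.refl (𝓡∂ 4) X ∞) y)) :=
    (((bW.isSmoothEmbedding.contMDiff.comp Ψ.contMDiff) _).mdifferentiableAt (by simp)).hasMFDerivAt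
  have hcomp := hΨd.comp y hRd
  have hfun : ((fun y => bW.incl (Ψ y)) ∘
      (BoundaryManifold.boundaryData 3 X).restrictDiffeomorph bX (Diffeomorph.refl (𝓡∂ 4) X ∞)) =
      fun y => (BoundaryManifold.boundaryData 3 W).incl (seamDiffeo bX bW Ψ y) :=
    funext fun y => (coe_seamDiffeo bX bW Ψ y).symm
  have h2 : mfderiv (𝓡 3) (𝓡∂ 4) (fun y => (BoundaryManifold.boundaryData 3 W).incl (seamDiffeo bX bW Ψ y)) y =
      (mfderiv (𝓡 3) (𝓡∂ 4) (fun y => bW.incl (Ψ y))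
        ((BoundaryManifold.boundaryData 3 X).restrictDiffeomorph bX (Diffeomorph.refl (𝓡∂ 4) X ∞) y)).comp
      (mfderiv (𝓡 3) (𝓡 3)
        ((BoundaryManifold.boundaryData 3 X).restrictDiffeomorph bX (Diffeomorph.refl (𝓡∂ 4) X ∞)) y) := by
    rw [← hfun]
    exact hcomp.mfderiv
  rw [h2]
  rfl

/-- **Concatenation of framing families with a propositional junction**: `IsFramingAlong.trans'`
after rewriting the start of the second family. [folklore] -/
theorem isFramingAlong_trans {W : Type} [TopologicalSpace W] [ChartedSpace (EuclideanHalfSpace 4) W]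
    [IsManifold (𝓡∂ 4) ∞ W] {K₀ K₁ K₂ : sphere (0 : EuclideanSpace ℝ (Fin 2)) 1 → W}
    {Φ : KnotIsotopyInBoundary K₀ K₁} {Ψ : KnotIsotopyInBoundary K₁ K₂}
    {ν ν₂ : sphere (0 : EuclideanSpace ℝ (Fin 2)) 1 → EuclideanSpace ℝ (Fin 4)}
    {νt₁ νt₂ : ℝ → sphere (0 : EuclideanSpace ℝ (Fin 2)) 1 → EuclideanSpace ℝ (Fin 4)}
    (h₁ : IsFramingAlong Φ ν νt₁) (h₂ : IsFramingAlong Ψ ν₂ νt₂) (e : νt₁ 1 = ν₂) :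
    IsFramingAlong (Φ.trans' Ψ) ν fun t => if t ≤ 1 / 2 then νt₁ (KnotIsotopyInBoundary.ρ₁ t)
      else νt₂ (KnotIsotopyInBoundary.ρ₂ t) := by
  subst e
  exact h₁.trans' h₂

/-- **Sub-goal `helper_isFramingAlong_trans` of stub `stub_steinRealisation`** (NF6 ▸ T3 ▸ T3c-3; wave 3,
lead c5): **concatenation of framing families along concatenated isotopies of knots in `∂W`, with a
propositional junction** — if `νt₁` is carried along `Φ` from `ν` and `νt₂` along `Ψ` from `ν₂ = νt₁ 1`,
then `t ↦ if t ≤ 1/2 then νt₁ (ρ₁ t) else νt₂ (ρ₂ t)` is carried along `Φ.trans' Ψ` from `ν`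
(`IsFramingAlong.trans'` of `LegendrianRealisationProofs.lean`, junction rewritten). [folklore] -/
theorem helper_isFramingAlong_trans : ∀ {W : Type} [TopologicalSpace W] [ChartedSpace (EuclideanHalfSpace 4) W] [IsManifold (𝓡∂ 4) ∞ W] {K₀ K₁ K₂ : Metric.sphere (0 : EuclideanSpace ℝ (Fin 2)) 1 → W} (Φ : Literature.Geometry.Symplectic.KnotIsotopyInBoundary K₀ K₁) (Ψ : Literature.Geometry.Symplectic.KnotIsotopyInBoundary K₁ K₂) (ν ν₂ : Metric.sphere (0 : EuclideanSpace ℝ (Fin 2)) 1 → EuclideanSpace ℝ (Fin 4)) (νt₁ νt₂ : ℝ → Metric.sphere (0 : EuclideanSpace ℝ (Fin 2)) 1 → EuclideanSpace ℝ (Fin 4)), Literature.Geometry.Symplectic.IsFramingAlong Φ ν νt₁ → Literature.Geometry.Symplectic.IsFramingAlong Ψ ν₂ νt₂ → νt₁ 1 = ν₂ → Literature.Geometry.Symplectic.IsFramingAlong (Φ.trans' Ψ) ν (fun t => if t ≤ 1 / 2 then νt₁ (Literature.Geometry.Symplectic.KnotIsotopyInBoundary.ρ₁ t) else νt₂ (Literature.Geometry.Symplectic.KnotIsotopyInBoundary.ρ₂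 t)) :=
  fun _ _ _ _ _ _ h₁ h₂ e => isFramingAlong_trans h₁ h₂ e

end Seam

/-! ## §3 The contract: node T3c-3 from the node statements T3c-1′ and T3c-2 -/

section Chain

set_option maxHeartbeats 400000 in
/-- **NODE T3c-3 (`node_dualLink_pageLink`) PROVED FROM THE NODE STATEMENTS T3c-1′ AND T3c-2** (the
contract of the T3c chain of the design file `T3_DualHandles_Design.lean` §2, checked by the kernel).
Data: a family `h` of 2-handle attaching maps on `Base g` indexed by the positions of `P ++ N`,
`X = Base g ∪_{h̄} (handles)` (data `D`), a boundary datum `bX` and a seam `Ψ : bX.carrier ≅ ∂ Base g`,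
a collar and scales for the dual maps; the suffix word `N` has non-zero classes and is uniformly
NEGATIVE (`x.2 = false`).  Hypotheses: `H1` = node T3c-1′ at the data (`node_belt_isotopic_pushoff`
with V6's corrected shadow clause `shadow = (l.get j).1 ∨ shadow = -(l.get j).1`), for every small
angle `η`; `H2` = the conclusion of node T3c-2 at the data (`node_seam_transport`: the global sign `s₀`
and the transport of finite families of framed page knots through `Ψ ∘ jA`).  Conclusion (what the NF6
assembly consumes, clause (i) of W7's `node_T3_dualPresentation`): attaching maps `h' j` on `Base g`,
`j < |N|`, with attaching circles in pages, of non-zero shadows, of ONE page twisting `±1`, pairwise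
disjoint ranges, such that every `W₂` which is `Base g` with 2-handles attached along the dual maps
`dualMap D bX (bBase g) Ψ col κ δ (|P| + j)` is `Base g` with 2-handles attached along `h'`.
[cite: Baykur2006, Thm. 5.1 (proof, p. 13)] -/
theorem dualLink_pageLink_of_nodes
    (g : ℕ) (P N : List ((Fin g ⊕ Fin g → ℤ) × Bool))
    (h : Fin (P ++ N).length → HandleAttachingMap 3 2 (Base g))
    {X : Type} [TopologicalSpace X] [T2Space X] [ChartedSpace (EuclideanHalfSpace 4) X]
    [IsManifold (𝓡∂ 4) ∞ X]
    (D : MultiAttachmentData h (𝓡∂ 4) X) (bX : BoundaryData (𝓡∂ 4) X (𝓡 3))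
    (Ψ : bX.carrier ≃ₘ⟮𝓡 3, 𝓡 3⟯ (bBase g).carrier)
    (col : (BoundaryManifold.boundaryData 3 (Base g)).Collar) (κ δ : ℝ) (hκ : 0 < κ) (hκ1 : κ ≤ 1)
    (hδ : 0 < δ) (hδ2 : δ ≤ 1 / 2)
    (hN0 : ∀ x ∈ N, x.1 ≠ 0) (hNs : ∀ x ∈ N, x.2 = false)
    -- (H1) = node T3c-1′ (`node_belt_isotopic_pushoff` with V6's corrected shadow clause) at the data
    (H1 : ∀ (η : ℝ), 0 < η → η * (P ++ N).length < Real.pi →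
      ∃ (σ₀ : ℤ) (K : Fin (P ++ N).length → sphere (0 : EuclideanSpace ℝ (Fin 2)) 1 → Base g)
        (ν : Fin (P ++ N).length → sphere (0 : EuclideanSpace ℝ (Fin 2)) 1 → EuclideanSpace ℝ (Fin 4))
        (hKc : ∀ j, Continuous (K j)) (hK : ∀ j θ, K j θ ∈ coresComplement h)
        (Φ : LinkIsotopyInBoundary (fun j => (beltMap D j).attachingCircle)
          (fun j θ => D.jA ⟨K j θ, hK j θ⟩))
        (νt : Fin (P ++ N).length → ℝ → sphere (0 : EuclideanSpace ℝ (Fin 2)) 1 → EuclideanSpace ℝ (Fin 4)),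
        (σ₀ = 1 ∨ σ₀ = -1) ∧
        (∀ (j : Fin (P ++ N).length) θ,
          K j θ ∈ page g (pageDir (P ++ N).length j * Complex.exp (-(η : ℂ) * Complex.I))) ∧
        (∀ j, IsBoundaryKnot (K j)) ∧ (∀ j, IsKnotFraming (K j) (ν j)) ∧
        (∀ j, shadow g (K j) (hKc j) = ((P ++ N).get j).1 ∨ shadow g (K j) (hKc j) = -((P ++ N).get j).1) ∧
        (∀ j, pageTwisting g (K j) (ν j) = σ₀ * (if ((P ++ N).get j).2 then -1 else 1)) ∧
        (∀ j, IsFramingAlong (Φ.isotopy j) (beltMap D j).attachingFraming (νt j)) ∧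
        (∀ j, FramingHomotopic (fun θ => D.jA ⟨K j θ, hK j θ⟩) (νt j 1)
          (fun θ => mfderiv (𝓡∂ 4) (𝓡∂ 4) (fun a : ↥(coresComplement h) => D.jA a)
            ⟨K j θ, hK j θ⟩ (ν j θ))))
    -- (H2) = the conclusion of node T3c-2 (`node_seam_transport`) at the data
    (H2 : ∃ s₀ : ℤ, (s₀ = 1 ∨ s₀ = -1) ∧
      ∀ (ι : Type) [Finite ι] (c : ι → ℂ) (_ : ∀ i, ‖c i‖ = 1) (_ : Injective c)
        (K : ι → sphere (0 : EuclideanSpace ℝ (Fin 2)) 1 → Base g)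
        (ν : ι → sphere (0 : EuclideanSpace ℝ (Fin 2)) 1 → EuclideanSpace ℝ (Fin 4))
        (hKc : ∀ i, Continuous (K i)) (hK : ∀ i θ, K i θ ∈ coresComplement h)
        (_ : ∀ i θ, K i θ ∈ page g (c i)) (_ : ∀ i, IsBoundaryKnot (K i))
        (_ : ∀ i, IsKnotFraming (K i) (ν i))
        (z : ι → sphere (0 : EuclideanSpace ℝ (Fin 2)) 1 → bX.carrier)
        (_ : ∀ i θ, bX.incl (z i θ) = D.jA ⟨K i θ, hK i θ⟩)
        (u : ι → sphere (0 : EuclideanSpace ℝ (Fin 2)) 1 → EuclideanSpace ℝ (Fin 3))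
        (_ : ∀ i θ, mfderiv (𝓡 3) (𝓡∂ 4) bX.incl (z i θ) (u i θ) =
          mfderiv (𝓡∂ 4) (𝓡∂ 4) (fun a : ↥(coresComplement h) => D.jA a) ⟨K i θ, hK i θ⟩ (ν i θ)),
        ∃ (A : ι → ((Fin g ⊕ Fin g → ℤ) ≃ₗ[ℤ] (Fin g ⊕ Fin g → ℤ)))
          (K' : ι → sphere (0 : EuclideanSpace ℝ (Fin 2)) 1 → Base g)
          (ν' : ι → sphere (0 : EuclideanSpace ℝ (Fin 2)) 1 → EuclideanSpace ℝ (Fin 4))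
          (hK'c : ∀ i, Continuous (K' i))
          (Φ : LinkIsotopyInBoundary (fun i θ => ((bBase g).incl (Ψ (z i θ)) : Base g)) K')
          (νt : ι → ℝ → sphere (0 : EuclideanSpace ℝ (Fin 2)) 1 → EuclideanSpace ℝ (Fin 4)),
          (∀ i θ, K' i θ ∈ page g (c i)) ∧ (∀ i, IsKnotFraming (K' i) (ν' i)) ∧
          (∀ i, shadow g (K' i) (hK'c i) = A i (shadow g (K i) (hKc i))) ∧
          (∀ i, pageTwisting g (K' i) (ν' i) = s₀ * pageTwisting g (K i) (ν i)) ∧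
          (∀ i, IsFramingAlong (Φ.isotopy i)
            (fun θ => mfderiv (𝓡 3) (𝓡∂ 4) (fun y => ((bBase g).incl (Ψ y) : Base g)) (z i θ) (u i θ))
            (νt i)) ∧
          (∀ i, FramingHomotopic (K' i) (νt i 1) (ν' i))) :
    ∃ (s : Bool) (h' : Fin N.length → HandleAttachingMap 3 2 (Base g)),
      (∀ j, ∃ c : ℂ, ‖c‖ = 1 ∧ ∀ θ, (h' j).attachingCircle θ ∈ page g c) ∧
      (∀ j, shadow g (h' j).attachingCircle (h' j).continuous_attachingCircle ≠ 0) ∧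
      (∀ j, pageTwisting g (h' j).attachingCircle (h' j).attachingFraming = if s then -1 else 1) ∧
      (Pairwise fun i j => Disjoint (range (h' i).toFun) (range (h' j).toFun)) ∧
      ∀ (W₂ : Type) [TopologicalSpace W₂] [ChartedSpace (EuclideanHalfSpace 4) W₂] [IsManifold (𝓡∂ 4) ∞ W₂],
        HandleAttachingMap.IsMultiAttachment
          (fun j : Fin N.length => dualMap D bX (bBase g) Ψ col κ δ hκ hκ1 hδ hδ2
            (Fin.cast List.length_append.symm (Fin.natAdd P.length j))) (𝓡∂ 4) W₂ →
        HandleAttachingMap.IsMultiAttachment h' (𝓡∂ 4) W₂ := by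
  classical
  -- the suffix positions
  let sfx : Fin N.length → Fin (P ++ N).length :=
    fun j => Fin.cast List.length_append.symm (Fin.natAdd P.length j)
  have hsfx_val : ∀ j, ((sfx j : Fin (P ++ N).length) : ℕ) = P.length + j := fun j => rfl
  have hsfx_inj : Injective sfx := fun j j' hjj' => by
    have h1 := congrArg Fin.val hjj'
    rw [hsfx_val, hsfx_val] at h1
    exact Fin.ext (by omega)
  have hget : ∀ j, (P ++ N).get (sfx j) = N.get j := fun j => get_append_natAdd P N j
  -- a small angle
  obtain ⟨η, hη, hηπ⟩ : ∃ η : ℝ, 0 < η ∧ η * (P ++ N).length < Real.pi := by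
    refine ⟨Real.pi / (2 * ((P ++ N).length + 1)), by positivity, ?_⟩
    rw [div_mul_eq_mul_div, div_lt_iff₀ (by positivity)]
    nlinarith [Real.pi_pos, (Nat.cast_nonneg ((P ++ N).length) : (0 : ℝ) ≤ _)]
  -- the nodes
  obtain ⟨σ₀, K, ν, hKc, hK, Φ₁, νt₁, hσ₀, hKpage, hKbk, hKfr, hKsh, hKtw, hfr₁, hend₁⟩ := H1 η hη hηπ
  obtain ⟨s₀, hs₀, H2'⟩ := H2
  -- the directions of the suffix pages
  have he1 : ‖Complex.exp (-(η : ℂ) * Complex.I)‖ = 1 := by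
    rw [show (-(η : ℂ) * Complex.I) = ((-η : ℝ) : ℂ) * Complex.I by push_cast; ring,
      Complex.norm_exp_ofReal_mul_I]
  have he0 : Complex.exp (-(η : ℂ) * Complex.I) ≠ 0 := Complex.exp_ne_zero _
  let c : Fin N.length → ℂ := fun j => pageDir (P ++ N).length (sfx j) * Complex.exp (-(η : ℂ) * Complex.I)
  have hc1 : ∀ j, ‖c j‖ = 1 := fun j => by
    show ‖pageDir (P ++ N).length (sfx j) * Complex.exp (-(η : ℂ) * Complex.I)‖ = 1
    rw [norm_mul, norm_pageDir, he1, mul_one]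
  have hcinj : Injective c := fun j j' hjj' => by
    have h1 : pageDir (P ++ N).length (sfx j) = pageDir (P ++ N).length (sfx j') :=
      mul_right_cancel₀ he0 hjj'
    exact hsfx_inj (Fin.ext (pageDir_injOn (sfx j).2 (sfx j').2 h1))
  -- the seam diffeomorphism of the canonical carriers; the identification `R : ∂X ≅ bX.carrier`
  let Gs := seamDiffeo bX (bBase g) Ψ
  let R := (BoundaryManifold.boundaryData 3 X).restrictDiffeomorph bX (Diffeomorph.refl (𝓡∂ 4) X ∞)
  -- (b): push the suffix part of the isotopy of (H1) along the seam
  obtain ⟨Φ₁s, hΦ₁s⟩ := exists_linkIsotopy_reindex Φ₁ sfx hsfx_inj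
  obtain ⟨hL, hL', Φ₁', νt₁', hfr₁', hνt₁'⟩ := helper_linkIsotopy_seamTransport Gs
    (fun j => (beltMap D (sfx j)).attachingCircle) (fun j θ => D.jA ⟨K (sfx j) θ, hK (sfx j) θ⟩)
    Φ₁s (fun j => (beltMap D (sfx j)).attachingFraming)
    (fun j => νt₁ (sfx j)) fun j => isFramingAlong_of_toFun_eq (hfr₁ (sfx j)) fun t => by rw [hΦ₁s j]
  -- the framing vectors `d(jA)(ν)` at the end knots of (H1) are tangent to `∂X`
  have hV0 := fun j θ =>
    (mem_boundaryTangentSpace_iff _).1 ((hend₁ j).isKnotFraming_right.mem_boundaryTangentSpace θ)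
  -- the lifts `z`, `u` consumed by (H2)
  let z : Fin N.length → sphere (0 : EuclideanSpace ℝ (Fin 2)) 1 → bX.carrier :=
    fun j θ => R ⟨D.jA ⟨K (sfx j) θ, hK (sfx j) θ⟩, hL' j θ⟩
  let uu : Fin N.length → sphere (0 : EuclideanSpace ℝ (Fin 2)) 1 → EuclideanSpace ℝ (Fin 3) :=
    fun j θ => mfderiv (𝓡 3) (𝓡 3) R ⟨D.jA ⟨K (sfx j) θ, hK (sfx j) θ⟩, hL' j θ⟩
      (tail 3 (mfderiv (𝓡∂ 4) (𝓡∂ 4) (fun a : ↥(coresComplement h) => D.jA a)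
        ⟨K (sfx j) θ, hK (sfx j) θ⟩ (ν (sfx j) θ)))
  have hzi : ∀ j θ, bX.incl (z j θ) = D.jA ⟨K (sfx j) θ, hK (sfx j) θ⟩ := fun j θ =>
    incl_restrict_refl bX _
  have hRd : ∀ y : (BoundaryManifold.boundaryData 3 X).carrier,
      HasMFDerivAt (𝓡 3) (𝓡 3) R y (mfderiv (𝓡 3) (𝓡 3) R y) := fun y =>
    ((R.contMDiff y).mdifferentiableAt (by simp)).hasMFDerivAt
  have hui : ∀ j θ, mfderiv (𝓡 3) (𝓡∂ 4) bX.incl (z j θ) (uu j θ) =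
      mfderiv (𝓡∂ 4) (𝓡∂ 4) (fun a : ↥(coresComplement h) => D.jA a)
        ⟨K (sfx j) θ, hK (sfx j) θ⟩ (ν (sfx j) θ) := by
    intro j θ
    have hId : HasMFDerivAt (𝓡 3) (𝓡∂ 4) bX.incl (R ⟨D.jA ⟨K (sfx j) θ, hK (sfx j) θ⟩, hL' j θ⟩)
        (mfderiv (𝓡 3) (𝓡∂ 4) bX.incl (R ⟨D.jA ⟨K (sfx j) θ, hK (sfx j) θ⟩, hL' j θ⟩)) :=
      ((bX.isSmoothEmbedding.contMDiff _).mdifferentiableAt (by simp)).hasMFDerivAt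
    have hcomp := hId.comp _ (hRd ⟨D.jA ⟨K (sfx j) θ, hK (sfx j) θ⟩, hL' j θ⟩)
    have hfun : (bX.incl ∘ R) = (BoundaryManifold.boundaryData 3 X).incl :=
      funext fun y => incl_restrict_refl bX y
    have h2 : mfderiv (𝓡 3) (𝓡∂ 4) (BoundaryManifold.boundaryData 3 X).incl
        ⟨D.jA ⟨K (sfx j) θ, hK (sfx j) θ⟩, hL' j θ⟩ =
        (mfderiv (𝓡 3) (𝓡∂ 4) bX.incl (R ⟨D.jA ⟨K (sfx j) θ, hK (sfx j) θ⟩, hL' j θ⟩)).comp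
          (mfderiv (𝓡 3) (𝓡 3) R ⟨D.jA ⟨K (sfx j) θ, hK (sfx j) θ⟩, hL' j θ⟩) := by
      rw [← hfun]
      exact hcomp.mfderiv
    have h3 := mfderiv_incl_tail (⟨D.jA ⟨K (sfx j) θ, hK (sfx j) θ⟩, hL' j θ⟩ :
      (BoundaryManifold.boundaryData 3 X).carrier) (hV0 (sfx j) θ)
    rw [h2] at h3
    exact h3
  -- (H2) applied to the end framed knots of (H1), suffix part
  obtain ⟨A, K', ν', hK'c, Φ₂, νt₂, hK'page, hK'fr, hK'sh, hK'tw, hfr₂, hend₂⟩ :=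
    H2' (Fin N.length) c hc1 hcinj (fun j => K (sfx j)) (fun j => ν (sfx j)) (fun j => hKc (sfx j))
      (fun j => hK (sfx j)) (fun j θ => hKpage (sfx j) θ) (fun j => hKbk (sfx j))
      (fun j => hKfr (sfx j)) z hzi uu hui
  -- the start of (H2)'s isotopy is the end of the pushed isotopy, knots …
  have hKz : ∀ j, (fun θ => ((bBase g).incl (Ψ (z j θ)) : Base g)) =
      fun θ => (BoundaryManifold.boundaryData 3 (Base g)).incl
        (Gs ⟨D.jA ⟨K (sfx j) θ, hK (sfx j) θ⟩, hL' j θ⟩) := fun j =>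
    funext fun θ => (coe_seamDiffeo bX (bBase g) Ψ _).symm
  -- … and framings
  have hσR : ∀ (y : (BoundaryManifold.boundaryData 3 X).carrier) (w : EuclideanSpace ℝ (Fin 3)),
      mfderiv (𝓡 3) (𝓡∂ 4) (fun y => ((bBase g).incl (Ψ y) : Base g)) (R y)
        (mfderiv (𝓡 3) (𝓡 3) R y w) =
      mfderiv (𝓡 3) (𝓡∂ 4) (fun y => (BoundaryManifold.boundaryData 3 (Base g)).incl (Gs y)) y w :=
    fun y w => mfderiv_seamDiffeo bX (bBase g) Ψ y w
  have hVz : ∀ j, (fun θ => mfderiv (𝓡 3) (𝓡∂ 4) (fun y => ((bBase g).incl (Ψ y) : Base g))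
      (z j θ) (uu j θ)) =
      fun θ => mfderiv (𝓡 3) (𝓡∂ 4) (fun y => (BoundaryManifold.boundaryData 3 (Base g)).incl (Gs y))
        ⟨D.jA ⟨K (sfx j) θ, hK (sfx j) θ⟩, hL' j θ⟩
        (tail 3 (mfderiv (𝓡∂ 4) (𝓡∂ 4) (fun a : ↥(coresComplement h) => D.jA a)
          ⟨K (sfx j) θ, hK (sfx j) θ⟩ (ν (sfx j) θ))) := fun j =>
    funext fun θ => hσR _ _
  -- the dual maps of the suffix handles: attaching circles and handle framings (piece (a))
  let q : Fin N.length → HandleAttachingMap 3 2 (Base g) :=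
    fun j => dualMap D bX (bBase g) Ψ col κ δ hκ hκ1 hδ hδ2 (sfx j)
  have hq0 : ∀ j, (q j).attachingCircle = fun u => (BoundaryManifold.boundaryData 3 (Base g)).incl
      (Gs ⟨(beltMap D (sfx j)).attachingCircle u, hL j u⟩) := fun j =>
    funext fun u => attachingCircle_pushedMap (beltMap D (sfx j)) Gs col κ δ hκ hκ1 hδ hδ2 u
  have hqf : ∀ j, (q j).attachingFraming = fun u =>
      κ • mfderiv (𝓡 3) (𝓡∂ 4) (fun y => (BoundaryManifold.boundaryData 3 (Base g)).incl (Gs y))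
        ⟨(beltMap D (sfx j)).attachingCircle u, hL j u⟩ (tail 3 ((beltMap D (sfx j)).attachingFraming u)) :=
    fun j => funext fun u => attachingFraming_pushedMap (beltMap D (sfx j)) Gs col κ δ hκ hκ1 hδ hδ2 u
  -- stage A: rescale the dual framing (refl isotopy at the dual attaching circles)
  have hBL0 : IsBoundaryLink fun j u => (BoundaryManifold.boundaryData 3 (Base g)).incl
      (Gs ⟨(beltMap D (sfx j)).attachingCircle u, hL j u⟩) := Φ₁'.isBoundaryLink_left
  have hBL1 : IsBoundaryLink fun j u => (BoundaryManifold.boundaryData 3 (Base g)).incl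
      (Gs ⟨D.jA ⟨K (sfx j) u, hK (sfx j) u⟩, hL' j u⟩) := Φ₁'.isBoundaryLink_right
  have hA : ∀ j, ∃ μ : ℝ → sphere (0 : EuclideanSpace ℝ (Fin 2)) 1 → EuclideanSpace ℝ (Fin 4),
      IsFramingAlong ((LinkIsotopyInBoundary.refl hBL0).isotopy j) (q j).attachingFraming μ ∧
      μ 1 = fun u => mfderiv (𝓡 3) (𝓡∂ 4) (fun y => (BoundaryManifold.boundaryData 3 (Base g)).incl (Gs y))
        ⟨(beltMap D (sfx j)).attachingCircle u, hL j u⟩ (tail 3 ((beltMap D (sfx j)).attachingFraming u)) := by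
    intro j
    obtain ⟨hKj, μ, hμ, hμ1⟩ := framingHomotopic_smul_pos (hBL0.isBoundaryKnot j)
      (hfr₁' j).isKnotFraming_zero hκ
    refine ⟨μ, ?_, hμ1⟩
    rw [hqf j]
    exact isFramingAlong_of_toFun_eq hμ fun t => rfl
  choose μA hμA hμA1 using hA
  -- stage C: push the end homotopy of framings of (H1) along the seam (refl isotopy at the end knots)
  have hC : ∀ j, ∃ μ : ℝ → sphere (0 : EuclideanSpace ℝ (Fin 2)) 1 → EuclideanSpace ℝ (Fin 4),
      IsFramingAlong ((LinkIsotopyInBoundary.refl hBL1).isotopy j) (νt₁' j 1) μ ∧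
      μ 1 = fun θ => mfderiv (𝓡 3) (𝓡∂ 4) (fun y => ((bBase g).incl (Ψ y) : Base g)) (z j θ) (uu j θ) := by
    intro j
    obtain ⟨hKj, μ, hμ, hμ1⟩ := framingHomotopic_seamPush Gs (hend₁ (sfx j))
      ((Φ₁.isotopy (sfx j)).isBoundaryKnot_right)
    refine ⟨μ, ?_, ?_⟩
    · rw [show νt₁' j 1 = fun u => mfderiv (𝓡 3) (𝓡∂ 4)
          (fun y => (BoundaryManifold.boundaryData 3 (Base g)).incl (Gs y))
          ⟨D.jA ⟨K (sfx j) u, hK (sfx j) u⟩, hL' j u⟩ (tail 3 (νt₁ (sfx j) 1 u)) from funext (hνt₁' j)]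
      exact isFramingAlong_of_toFun_eq hμ fun t => rfl
    · rw [hμ1, hVz j]
      rfl
  choose μC hμC hμC1 using hC
  -- stage D: (H2)'s isotopy, its start re-read as the end of the pushed isotopy
  obtain ⟨Φ₂', hΦ₂'⟩ := exists_linkIsotopy_of_eq
    (M := fun j u => (BoundaryManifold.boundaryData 3 (Base g)).incl
      (Gs ⟨D.jA ⟨K (sfx j) u, hK (sfx j) u⟩, hL' j u⟩)) (M' := K') Φ₂ (funext fun j => hKz j) rfl
  -- the total isotopy of links, from the dual attaching circles to `K'`
  obtain ⟨ΘAB, hΘAB⟩ := exists_linkIsotopy_trans (LinkIsotopyInBoundary.refl hBL0) Φ₁'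
  obtain ⟨ΘABC, hΘABC⟩ := exists_linkIsotopy_trans ΘAB (LinkIsotopyInBoundary.refl hBL1)
  obtain ⟨ΘABCD, hΘABCD⟩ := exists_linkIsotopy_trans ΘABC Φ₂'
  obtain ⟨Φtot, hΦtot⟩ := exists_linkIsotopy_of_eq (M := fun j => (q j).attachingCircle) (M' := K') ΘABCD
    (funext fun j => (hq0 j).symm) rfl
  have htot : ∀ j, ∃ μ : ℝ → sphere (0 : EuclideanSpace ℝ (Fin 2)) 1 → EuclideanSpace ℝ (Fin 4),
      IsFramingAlong (Φtot.isotopy j) (q j).attachingFraming μ ∧ μ 1 = νt₂ j 1 := by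
    intro j
    have hD : IsFramingAlong (Φ₂'.isotopy j)
        (fun θ => mfderiv (𝓡 3) (𝓡∂ 4) (fun y => ((bBase g).incl (Ψ y) : Base g)) (z j θ) (uu j θ))
        (νt₂ j) :=
      isFramingAlong_of_toFun_eq (hfr₂ j) (hΦ₂' j)
    have hAB := isFramingAlong_trans (hμA j) (hfr₁' j) (hμA1 j)
    have hABC := isFramingAlong_trans hAB (hμC j) (by
      show (if (1 : ℝ) ≤ 1 / 2 then _ else _) = _
      rw [if_neg (by norm_num), KnotIsotopyInBoundary.ρ₂_one])
    have hABCD := isFramingAlong_trans hABC hD (by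
      show (if (1 : ℝ) ≤ 1 / 2 then _ else _) = _
      rw [if_neg (by norm_num), KnotIsotopyInBoundary.ρ₂_one, hμC1 j])
    refine ⟨_, isFramingAlong_of_toFun_eq hABCD fun t => ?_, ?_⟩
    · rw [hΦtot j t, hΘABCD j, hΘABC j, hΘAB j]
    · show (if (1 : ℝ) ≤ 1 / 2 then _ else _) = _
      rw [if_neg (by norm_num), KnotIsotopyInBoundary.ρ₂_one]
  choose μ hμ hμ1 using htot
  -- the bookkeeping of (H1) and (H2): pages, shadows, twisting
  have hε : s₀ * σ₀ = 1 ∨ s₀ * σ₀ = -1 := by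
    rcases hs₀ with h1 | h1 <;> rcases hσ₀ with h2 | h2 <;> subst h1 <;> subst h2 <;> norm_num
  have hsh' : ∀ j, shadow g (K' j) (hK'c j) ≠ 0 := by
    intro j h0
    rw [hK'sh j] at h0
    have h1 : shadow g (K (sfx j)) (hKc (sfx j)) = 0 := (A j).map_eq_zero_iff.1 h0
    have h2 := hN0 _ (List.get_mem N j)
    rcases hKsh (sfx j) with h3 | h3 <;> rw [h1, hget j] at h3
    · exact h2 h3.symm
    · exact h2 (neg_eq_zero.1 h3.symm)
  have htw' : ∀ j, pageTwisting g (K' j) (ν' j) = s₀ * σ₀ := by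
    intro j
    rw [hK'tw j, hKtw (sfx j), hget j, hNs _ (List.get_mem N j)]
    simp
  have hend' : ∀ j, FramingHomotopic (K' j) (μ j 1) (ν' j) := fun j => by rw [hμ1 j]; exact hend₂ j
  -- ISO + TUBE on the base side
  obtain ⟨s, h', -, hpg, hsh, htw, hdis, hiso⟩ := helper_dualLink_pageLink_of g (Fin N.length) q c K' ν'
    Φtot μ hK'c (s₀ * σ₀) hc1 hK'page hμ hend' hsh' hε htw'
  exact ⟨s, h', hpg, hsh, htw, hdis, hiso⟩

end Chain

end Summit.SmoothPoincare4.SmoothPoincare4.Theorems.AcyclicBisectionExists.ModpBraidOrbits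

end
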